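import Mathlib
import Summits.CriticalPhenomena.PercolationContinuityZ3.Theorems.PercNearOneGluingNoHeavyLowerTailOrientedAntipodalHallChain
import Summits.CriticalPhenomena.PercolationContinuityZ3.Theorems.PercNearOneGluingNoHeavyLowerTailOrderedDifferences

/-!
# Chain classes of antipodal bads: the capacity-one Hall inequality, unconditionally

Helper file for crux `stmt-CriticalPhenomena-4575` (`NoHeavyLowerTail`, route `PercNearOneGluingNoHeavy`),
new-inequality factory seat `prim-ineq-gen-3` (gen 5).  Everything here is PROVED.

`OrientedAntipodalHall.card_add_card_le_card_goods_above_chain` (gen 3) reduced the capacity-one Hall count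
for a *chain* pair of ordered bad types `(i,j), (j,l)` of a sunflower labeling to the two-family
Marica–Schönheim inequality `MS2′`, taken there as the hypothesis `hMS`.  `MS2′` is now a theorem
(`OrderedDifferences.card_add_card_le_card_diffs_union`, ordered Marica–Schönheim via Möbius-weighted rank),
so the chain count holds outright (`card_add_card_le_card_goods_above_chain'`, needing only `i ≠ l` to
exclude the opposite pair `(i,j),(j,i)`, for which capacity one genuinely fails), and with it the SDR form
(`exists_injective_good_above_chain`): the bads of a chain pair of types admit DISTINCT good representatives
above them.  Together with the separated classes (`card_le_card_goods_above`, stars and single types) this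
settles Conjecture O of the memo for every class of at most two ordered types other than an opposite pair;
what remains of O is the genuinely three-type step (conjecture `MS3′`,
`card_le_card_goods_above_transitive`).
(prim-ineq-gen-3 gen 5, 2026-08-20; memo `run/shared/lean/prim/prim-ineq-gen-3/COMB.md` §3c (x)–(xii), (xviii).)
-/

namespace Summit.CriticalPhenomena.PercolationContinuityZ3.Theorems

namespace OrientedAntipodalHall

open Finset AntipodalStrongHarris AntipodalStrongHarris.Lab OrderedDifferences
open scoped FinsetFamily

variable {α : Type*} [DecidableEq α] {k : ℕ}

/-- Two petals are comparable only if they are equal. -/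
theorem eq_of_petal_le_petal {i l : Fin k} (h : (petal i : Lab k) ≤ petal l) : i = l := by
  rw [le_def] at h
  rcases h with h | h | h
  · cases h
  · cases h
  · exact Lab.petal.inj h

/-- For a chain pair of types `(i,j), (j,l)` with `i ≠ l`, no complement `S \ A` of an `(i,j)`-bad `A` is
contained in a `(j,l)`-bad `B` (else `S \ B ⊆ A` would force `C_l ≤ C_i`). -/
theorem not_compl_subset_of_chain (S : Finset α) {f : Finset α → Lab k}
    (hf : ∀ ⦃X Y : Finset α⦄, X ⊆ Y → f X ≤ f Y) {i l : Fin k} (hil : i ≠ l) {A B : Finset α}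
    (hAi : f A = petal i) (hBl : f (S \ B) = petal l) : ¬ S \ A ⊆ B := by
  intro hAB
  have hsub : S \ B ⊆ A := by
    intro x hx
    rw [mem_sdiff] at hx
    by_contra hxA
    exact hx.2 (hAB (mem_sdiff.mpr ⟨hx.1, hxA⟩))
  have hle : (petal l : Lab k) ≤ petal i := by
    rw [← hBl, ← hAi]
    exact hf hsub
  exact hil (eq_of_petal_le_petal hle).symm

/-- **Chain classes: the capacity-one Hall count, unconditionally.**  Let `f` be a sunflower labeling,
`D₁` a family of antipodal bads of type `(i,j)` and `D₂` of type `(j,l)` inside `S`, with `i ≠ j`,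
`j ≠ l`, `i ≠ l`.  Then at least `#D₁ + #D₂` good sets `U ⊆ S` (`f U = A`, `f (S \ U) = B`) contain a member
of `D₁ ∪ D₂`.  (Gen 3's reduction `card_add_card_le_card_goods_above_chain` with its hypothesis `hMS`
discharged by `MS2′`.) -/
theorem card_add_card_le_card_goods_above_chain' (S : Finset α) {f : Finset α → Lab k}
    (hf : ∀ ⦃X Y : Finset α⦄, X ⊆ Y → f X ≤ f Y) (D₁ D₂ : Finset (Finset α)) {i j l : Fin k}
    (hij : i ≠ j) (hjl : j ≠ l) (hil : i ≠ l)
    (h₁S : ∀ A ∈ D₁, A ⊆ S) (h₁i : ∀ A ∈ D₁, f A = petal i) (h₁j : ∀ A ∈ D₁, f (S \ A) = petal j)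
    (h₂S : ∀ B ∈ D₂, B ⊆ S) (h₂j : ∀ B ∈ D₂, f B = petal j) (h₂l : ∀ B ∈ D₂, f (S \ B) = petal l) :
    #D₁ + #D₂ ≤ #{U ∈ S.powerset | f U = top ∧ f (S \ U) = bot ∧ ∃ X ∈ D₁ ∪ D₂, X ⊆ U} := by
  refine card_add_card_le_card_goods_above_chain S hf D₁ D₂ hij hjl h₁S h₁i h₁j h₂S h₂j h₂l ?_
  refine card_add_card_le_card_diffs_union _ _ ?_
  intro C hC B hB
  obtain ⟨A, hA, rfl⟩ := mem_image.mp hC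
  exact not_compl_subset_of_chain S hf hil (h₁i A hA) (h₂l B hB)

/-- **Chain classes: SDR form.**  Under the hypotheses of `card_add_card_le_card_goods_above_chain'`, the
members of `D₁ ∪ D₂` admit DISTINCT good representatives above them: an injective `φ` on `D₁ ∪ D₂` with
`X ⊆ φ X ⊆ S`, `f (φ X) = A`, `f (S \ φ X) = B`. -/
theorem exists_injective_good_above_chain (S : Finset α) {f : Finset α → Lab k}
    (hf : ∀ ⦃X Y : Finset α⦄, X ⊆ Y → f X ≤ f Y) (D₁ D₂ : Finset (Finset α)) {i j l : Fin k}
    (hij : i ≠ j) (hjl : j ≠ l) (hil : i ≠ l)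
    (h₁S : ∀ A ∈ D₁, A ⊆ S) (h₁i : ∀ A ∈ D₁, f A = petal i) (h₁j : ∀ A ∈ D₁, f (S \ A) = petal j)
    (h₂S : ∀ B ∈ D₂, B ⊆ S) (h₂j : ∀ B ∈ D₂, f B = petal j) (h₂l : ∀ B ∈ D₂, f (S \ B) = petal l) :
    ∃ φ : ↥(D₁ ∪ D₂) → Finset α, Function.Injective φ ∧
      ∀ X : ↥(D₁ ∪ D₂), (X : Finset α) ⊆ φ X ∧ φ X ⊆ S ∧ f (φ X) = top ∧ f (S \ φ X) = bot := by
  classical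
  -- Hall's marriage theorem for the relation `X ↦ good sets above X`
  let t : ↥(D₁ ∪ D₂) → Finset (Finset α) := fun X =>
    {U ∈ S.powerset | f U = top ∧ f (S \ U) = bot ∧ (X : Finset α) ⊆ U}
  have hHall : ∀ s : Finset ↥(D₁ ∪ D₂), #s ≤ #(s.biUnion t) := by
    intro s
    set D' : Finset (Finset α) := s.map (Function.Embedding.subtype _) with hD'
    have hD'sub : ∀ X ∈ D', X ∈ D₁ ∪ D₂ := by
      intro X hX
      obtain ⟨x, -, rfl⟩ := mem_map.mp hX
      exact x.2
    -- split the sub-family along the two types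
    set E₁ : Finset (Finset α) := D'.filter (· ∈ D₁) with hE₁
    set E₂ : Finset (Finset α) := D'.filter (· ∉ D₁) with hE₂
    have hE₁sub : ∀ X ∈ E₁, X ∈ D₁ := fun X hX => (mem_filter.mp hX).2
    have hE₂sub : ∀ X ∈ E₂, X ∈ D₂ := by
      intro X hX
      obtain ⟨hXD', hX1⟩ := mem_filter.mp hX
      rcases mem_union.mp (hD'sub X hXD') with h | h
      · exact absurd h hX1
      · exact h
    have hcard : #s = #E₁ + #E₂ := by
      rw [hE₁, hE₂, card_filter_add_card_filter_not]
      exact (card_map _).symm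
    have hle := card_add_card_le_card_goods_above_chain' S hf E₁ E₂ hij hjl hil
      (fun X hX => h₁S X (hE₁sub X hX)) (fun X hX => h₁i X (hE₁sub X hX))
      (fun X hX => h₁j X (hE₁sub X hX)) (fun X hX => h₂S X (hE₂sub X hX))
      (fun X hX => h₂j X (hE₂sub X hX)) (fun X hX => h₂l X (hE₂sub X hX))
    have hED' : ∀ X ∈ E₁ ∪ E₂, X ∈ D' := by
      intro X hX
      rcases mem_union.mp hX with h | h
      · exact (mem_filter.mp h).1
      · exact (mem_filter.mp h).1
    have hgoods : {U ∈ S.powerset | f U = top ∧ f (S \ U) = bot ∧ ∃ X ∈ E₁ ∪ E₂, X ⊆ U} ⊆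
        s.biUnion t := by
      intro U hU
      rw [mem_filter, mem_powerset] at hU
      obtain ⟨hUS, hUtop, hUbot, X, hX, hXU⟩ := hU
      obtain ⟨x, hx, rfl⟩ := mem_map.mp (hED' X hX)
      rw [mem_biUnion]
      refine ⟨x, hx, ?_⟩
      simp only [t, mem_filter, mem_powerset]
      exact ⟨hUS, hUtop, hUbot, hXU⟩
    calc #s = #E₁ + #E₂ := hcard
      _ ≤ #{U ∈ S.powerset | f U = top ∧ f (S \ U) = bot ∧ ∃ X ∈ E₁ ∪ E₂, X ⊆ U} := hle
      _ ≤ #(s.biUnion t) := card_le_card hgoods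
  obtain ⟨φ, hφinj, hφ⟩ := (all_card_le_biUnion_card_iff_exists_injective t).mp hHall
  refine ⟨φ, hφinj, fun X => ?_⟩
  have hX := hφ X
  simp only [t, mem_filter, mem_powerset] at hX
  exact ⟨hX.2.2.2, hX.1, hX.2.1, hX.2.2.1⟩

end OrientedAntipodalHall

end Summit.CriticalPhenomena.PercolationContinuityZ3.Theorems
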